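/-
Origin: expansion seat `prover-pub-hodgecm-mc-binder-2-g17-0`, handover #90 2026-08-20T20:08Z md5 c16f878216bd (NEW; 233 l.; ns `HodgeCM.Model.CommonReflexInput` + `HodgeCM.Model` + `HodgeCM.Model.LiuCMSide`; (J5-dict): `CommonReflexInput.inflate_comp_eq_of_corner` (transport `inflate (k ∘ e) Ψ = ΦA`), `isCMTypeRealisation_inflate_of_corner`, DATA def `CommonReflexInput.ofReflexData` (:= binder-1's `ofInflated M (k.comp e.toRingHom) A ιA θA _ τ hτ`) + `_A`/`_τ`/`_M` (rfl) /`_ΦA`, `pull_baseChange_mem_classes_ofReflexData`, `Model.pull_baseChange_mem_surfaceClasses_ofReflexData`, `Model.exists_commonReflexInput_forall_pull_mem`; DATA structure `Model.LiuCMSide` (context-free CM side of one μ: `K' Φ' M k A ιA θA ΦA hΦA isRealisation τ α α_mem` = [Liu21] Def 4.3/4.5 shape), predicate `LiuCMSide.IsCorner C K Ψ σ := ∃ e : K ≃+* C.K', (Φ' ↔ Ψ under e) ∧ C.τ ∘ C.k ∘ e = σ`, MAIN `LiuCMSide.exists_commonReflexInput_of_isCorner (h : C.IsCorner K Ψ σ)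 (V) : ∃ D : CommonReflexInput K Ψ σ, D.A = C.A ∧ ∀ Γ (f : P_Γ.X ⟶ C.A.X), (pull f 1).baseChange ℂ C.α ∈ D.surfaceClasses hHD hI h₁ h₃ V Γ`. CERT lane farm lean-direct on the RUN-60 PKG oleans (imports unchanged in RUN 61) rc 0 ∕ 31 s ∕ 0 warn ∕ proof holes 0; `#print axioms` 10 ∕ 10 ⊆ trio (`g17/farm/logs/ax_j5dict.log` 7b60c30f8851); FQN 0 hits in PKG lists 9e372979b8a0; NAME LIST: `HodgeCM.Model.LiuCMSide.exists_commonReflexInput_of_isCorner` · `HodgeCM.Model.exists_commonReflexInput_forall_pull_mem` · `HodgeCM.Model.CommonReflexInput.inflate_comp_eq_of_corner`) (`HOME/mc/pub-hodgecm-mc-binder-2/g17/stage62/HodgeCM/Model/Binders/JLiuCommonReflexOfCMData.lean`, md5 c16f878216bd, 233 lines);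
landed by the second packager p2 gen 13 (p2-g13) in gate run 62 as `HodgeCM/Model/Binders/JLiuCommonReflexOfCMData.lean` (verbatim).
-/
/-
binder-2 lane (unit pub-hodgecm-mc-binder-2-g17, seat prover-pub-hodgecm-mc-binder-2-g17-0), 2026-08-20.
(J-Liu-Θ) junction behind E's row 9 `hΘ` — item (J5-dict): the `hJ5` input of axioms-1-g15's junction theorem
`subset_span_of_liuDictionary` (J3-DESIGN §4) from Liu-typed CM data + the (J4a)/(J5) corner match, via binder-1's (J5a)
constructor `CommonReflexInput.ofInflated`.  Imports that PKG module ONLY.  No `Prop` minted; nothing of E / row 9 / MODEL-N touched.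
-/
import Summits.HodgeConjecture.HodgeCM.Model.CommonReflexOfInflated

set_option autoImplicit false

/-!
# (J5-dict): the common-reflex datum of a corner from CM data typed RELATIVE TO A REFLEX PAIR

[Liu21] (= arXiv:2102.11518) Def. 4.3 / 4.5 deliver, for a weight-one `μ`: the reflex pair `(M'_μ, Ψ_μ)` of `(E, Φ_μ)` (a field
with a CM type — here an ABSTRACT pair `(K', Φ')`), a number field `M_μ ⊇ M'_μ` (here `k : K' →+* M`), and an abelian variety `A_μ`
with `M_μ`-multiplication whose CM type is the INFLATION of `Ψ_μ` along `M'_μ ⊂ M_μ` (here `ΦA` with `hΦA`), read in `ℂ` through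
`τ : M →+* ℂ` (`M_μ ⊂ ℂ`); the proof of Thm. 4.18 pulls back a `τ`-eigenvector `α`.  The junction's per-context input (J4a)+(J5)
(binder-1 #R85–#R88, binder-2 #84–#86; theta-3 (T4)) is the CORNER MATCH: an isomorphism `e : c.K ≃+* K'` carrying the corner type
`c.Ψ i` to `Φ'` and `c.σ` to `τ ∘ k ∘ e`.  From these:

* `HodgeCM.Model.CommonReflexInput.inflate_comp_eq_of_corner` — transport: `inflate (k ∘ e) Ψ = ΦA`;
* `HodgeCM.Model.CommonReflexInput.ofReflexData` — the datum `D : CommonReflexInput K Ψ σ` (:= `ofInflated M (k ∘ e) A ιA θA _ τ _`);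
* `HodgeCM.Model.CommonReflexInput.pull_baseChange_mem_classes_ofReflexData` /
  `HodgeCM.Model.pull_baseChange_mem_surfaceClasses_ofReflexData` — for EVERY `ℂ`-morphism `f : X ⟶ A` (resp. `f : P_Γ ⟶ A`) and every
  `τ`-eigenvector `α`, the class `(f^*)_ℂ α` lies in `D.classes X` (resp. `D.surfaceClasses … V Γ`) — i.e. the `hJ5` hypothesis of
  `subset_span_of_liuDictionary` holds DEFINITIONALLY for data so typed (and for the CM-minimal reading (C2) of Thm 4.18 (1), which
  quantifies over all `ℂ`-morphisms `P_Γ → A_μ ⊗ ℂ`).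

KIND: kernel, 0 proof holes, nothing cited anew; expected `#print axioms` ⊆ {propext, Classical.choice, Quot.sound}.
-/

noncomputable section

open scoped TensorProduct
open NumberField CategoryTheory Module

namespace HodgeCM

namespace Model

open Literature.AlgebraicGeometry.Motives (CMType AbelianVariety bettiCohomology SchemeOver)
open Literature.AlgebraicGeometry.HodgeTheory
open Literature.AlgebraicGeometry.HodgeTheory.BettiUniverse (pull cmAction IsInducedOnIntegers)
open Literature.AlgebraicGeometry.ComplexMultiplication (IsCMTypeRealisation)
open Literature.NumberTheory.Automorphic.PicardCM
open HodgeCM.CMTypeOps (inflate mem_inflate_iff)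

namespace CommonReflexInput

variable {K : CMField} {Ψ : CMType K} {σ : K →+* ℂ}

/-- Transport of types along the corner match: if `Φ' ⊆ Hom(K', ℂ)` corresponds to `Ψ` under `e : K ≃+* K'` and `ΦA` is the
inflation of `Φ'` along `k : K' → M`, then `ΦA` is the inflation of `Ψ` along `k ∘ e`. [folklore] -/
theorem inflate_comp_eq_of_corner {K' : Type} [Field K'] (e : K ≃+* K') (Φ' : Set (K' →+* ℂ))
    (hΨ : ∀ ψ : K' →+* ℂ, ψ ∈ Φ' ↔ ψ.comp e.toRingHom ∈ Ψ.1)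
    {M : Type} [Field M] (k : K' →+* M) (ΦA : CMType M) (hΦA : ∀ θ : M →+* ℂ, θ ∈ ΦA.1 ↔ θ.comp k ∈ Φ') :
    inflate (k.comp e.toRingHom) Ψ = ΦA := by
  refine Subtype.ext (Set.ext fun θ => ?_)
  rw [mem_inflate_iff, hΦA θ, hΨ (θ.comp k), RingHom.comp_assoc]

/-- The realisation hypothesis re-read for the inflated type `Ψ^M` along `k ∘ e`. [folklore] -/
theorem isCMTypeRealisation_inflate_of_corner {K' : Type} [Field K'] (e : K ≃+* K') (Φ' : Set (K' →+* ℂ))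
    (hΨ : ∀ ψ : K' →+* ℂ, ψ ∈ Φ' ↔ ψ.comp e.toRingHom ∈ Ψ.1)
    {M : Type} [Field M] [NumberField M] (k : K' →+* M)
    {A : AbelianVariety ℂ} {ιA : 𝓞 M →+* End A} {θA : M →+* Module.End ℂ (complexBetti A.X 1)}
    {ΦA : CMType M} (hΦA : ∀ θ : M →+* ℂ, θ ∈ ΦA.1 ↔ θ.comp k ∈ Φ')
    (hA : IsCMTypeRealisation ΦA A ιA θA) : IsCMTypeRealisation (inflate (k.comp e.toRingHom) Ψ) A ιA θA := by
  rw [inflate_comp_eq_of_corner e Φ' hΨ k ΦA hΦA]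
  exact hA

/-- **(J5-dict) The common-reflex datum at the corner `(K, Ψ, σ)` from CM data typed relative to a reflex pair `(K', Φ')`
matched to the corner by `e`** — binder-1's `ofInflated` at `k₂ := k ∘ e`. [folklore] -/
def ofReflexData {K' : Type} [Field K'] (e : K ≃+* K') (Φ' : Set (K' →+* ℂ))
    (hΨ : ∀ ψ : K' →+* ℂ, ψ ∈ Φ' ↔ ψ.comp e.toRingHom ∈ Ψ.1)
    (M : Type) [Field M] [NumberField M] (k : K' →+* M)
    (A : AbelianVariety ℂ) (ιA : 𝓞 M →+* End A) (θA : M →+* Module.End ℂ (complexBetti A.X 1))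
    (ΦA : CMType M) (hΦA : ∀ θ : M →+* ℂ, θ ∈ ΦA.1 ↔ θ.comp k ∈ Φ')
    (hA : IsCMTypeRealisation ΦA A ιA θA) (τ : M →+* ℂ) (hτ : τ.comp (k.comp e.toRingHom) = σ) : CommonReflexInput K Ψ σ :=
  ofInflated M (k.comp e.toRingHom) A ιA θA (isCMTypeRealisation_inflate_of_corner e Φ' hΨ k hΦA hA) τ hτ

/-- (Ported verbatim from the HodgeCMPerL package; no docstring in the source.) -/
@[simp] theorem ofReflexData_A {K' : Type} [Field K'] (e : K ≃+* K') (Φ' : Set (K' →+* ℂ))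
    (hΨ : ∀ ψ : K' →+* ℂ, ψ ∈ Φ' ↔ ψ.comp e.toRingHom ∈ Ψ.1)
    (M : Type) [Field M] [NumberField M] (k : K' →+* M)
    (A : AbelianVariety ℂ) (ιA : 𝓞 M →+* End A) (θA : M →+* Module.End ℂ (complexBetti A.X 1))
    (ΦA : CMType M) (hΦA : ∀ θ : M →+* ℂ, θ ∈ ΦA.1 ↔ θ.comp k ∈ Φ')
    (hA : IsCMTypeRealisation ΦA A ιA θA) (τ : M →+* ℂ) (hτ : τ.comp (k.comp e.toRingHom) = σ) :
    (ofReflexData e Φ' hΨ M k A ιA θA ΦA hΦA hA τ hτ).A = A := rfl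

/-- (Ported verbatim from the HodgeCMPerL package; no docstring in the source.) -/
@[simp] theorem ofReflexData_τ {K' : Type} [Field K'] (e : K ≃+* K') (Φ' : Set (K' →+* ℂ))
    (hΨ : ∀ ψ : K' →+* ℂ, ψ ∈ Φ' ↔ ψ.comp e.toRingHom ∈ Ψ.1)
    (M : Type) [Field M] [NumberField M] (k : K' →+* M)
    (A : AbelianVariety ℂ) (ιA : 𝓞 M →+* End A) (θA : M →+* Module.End ℂ (complexBetti A.X 1))
    (ΦA : CMType M) (hΦA : ∀ θ : M →+* ℂ, θ ∈ ΦA.1 ↔ θ.comp k ∈ Φ')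
    (hA : IsCMTypeRealisation ΦA A ιA θA) (τ : M →+* ℂ) (hτ : τ.comp (k.comp e.toRingHom) = σ) :
    (ofReflexData e Φ' hΨ M k A ιA θA ΦA hΦA hA τ hτ).τ = τ := rfl

/-- (Ported verbatim from the HodgeCMPerL package; no docstring in the source.) -/
theorem ofReflexData_M {K' : Type} [Field K'] (e : K ≃+* K') (Φ' : Set (K' →+* ℂ))
    (hΨ : ∀ ψ : K' →+* ℂ, ψ ∈ Φ' ↔ ψ.comp e.toRingHom ∈ Ψ.1)
    (M : Type) [Field M] [NumberField M] (k : K' →+* M)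
    (A : AbelianVariety ℂ) (ιA : 𝓞 M →+* End A) (θA : M →+* Module.End ℂ (complexBetti A.X 1))
    (ΦA : CMType M) (hΦA : ∀ θ : M →+* ℂ, θ ∈ ΦA.1 ↔ θ.comp k ∈ Φ')
    (hA : IsCMTypeRealisation ΦA A ιA θA) (τ : M →+* ℂ) (hτ : τ.comp (k.comp e.toRingHom) = σ) :
    (ofReflexData e Φ' hΨ M k A ιA θA ΦA hΦA hA τ hτ).M = M := rfl

/-- (Ported verbatim from the HodgeCMPerL package; no docstring in the source.) -/
theorem ofReflexData_ΦA {K' : Type} [Field K'] (e : K ≃+* K') (Φ' : Set (K' →+* ℂ))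
    (hΨ : ∀ ψ : K' →+* ℂ, ψ ∈ Φ' ↔ ψ.comp e.toRingHom ∈ Ψ.1)
    (M : Type) [Field M] [NumberField M] (k : K' →+* M)
    (A : AbelianVariety ℂ) (ιA : 𝓞 M →+* End A) (θA : M →+* Module.End ℂ (complexBetti A.X 1))
    (ΦA : CMType M) (hΦA : ∀ θ : M →+* ℂ, θ ∈ ΦA.1 ↔ θ.comp k ∈ Φ')
    (hA : IsCMTypeRealisation ΦA A ιA θA) (τ : M →+* ℂ) (hτ : τ.comp (k.comp e.toRingHom) = σ) :
    (ofReflexData e Φ' hΨ M k A ιA θA ΦA hΦA hA τ hτ).ΦA = ΦA :=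
  inflate_comp_eq_of_corner e Φ' hΨ k ΦA hΦA

/-- Every pull-back `(f^*)_ℂ α` of a `τ`-eigenvector `α` along ANY `ℂ`-morphism `f : X ⟶ A` is a class of the datum on `X`.
[folklore] -/
theorem pull_baseChange_mem_classes_ofReflexData {K' : Type} [Field K'] (e : K ≃+* K') (Φ' : Set (K' →+* ℂ))
    (hΨ : ∀ ψ : K' →+* ℂ, ψ ∈ Φ' ↔ ψ.comp e.toRingHom ∈ Ψ.1)
    (M : Type) [Field M] [NumberField M] (k : K' →+* M)
    (A : AbelianVariety ℂ) (ιA : 𝓞 M →+* End A) (θA : M →+* Module.End ℂ (complexBetti A.X 1))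
    (ΦA : CMType M) (hΦA : ∀ θ : M →+* ℂ, θ ∈ ΦA.1 ↔ θ.comp k ∈ Φ')
    (hA : IsCMTypeRealisation ΦA A ιA θA) (τ : M →+* ℂ) (hτ : τ.comp (k.comp e.toRingHom) = σ)
    (X : SchemeOver ℂ) (f : X ⟶ A.X) (α : ℂ ⊗[ℚ] bettiCohomology A.X 1)
    (hα : α ∈ eigenline (HodgeCM.CM.CommonReflex.complexify (cmAction θA hA.isInducedOnIntegers)) τ) :
    (pull f 1).baseChange ℂ α ∈ (ofReflexData e Φ' hΨ M k A ιA θA ΦA hΦA hA τ hτ).classes X :=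
  ⟨f, α, hα, rfl⟩

end CommonReflexInput

variable (hHD : exists_isReal_hodgeModel) (hI : hodgePQ_independent_of_hodgeModel)
  (h₁ : BallQuotientUniformised) (h₃ : CMAbelianVarietyRealised)

/-- **`hJ5` of the junction, definitionally**: on THE realised surface `P_Γ` of the end-state universe, every pull-back of a
`τ`-eigenvector of `A` along a `ℂ`-morphism `P_Γ ⟶ A` is a surface class of the datum `ofReflexData …` — for every level `Γ`
and every `f` (the quantifier shape of J3-DESIGN §4's `hJ5 : ∃ D, ∀ Γ f, geomClass Γ μ f ∈ D.surfaceClasses … V Γ`). [folklore] -/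
theorem pull_baseChange_mem_surfaceClasses_ofReflexData
    {K : CMField} {Ψ : CMType K} {σ : K →+* ℂ}
    {K' : Type} [Field K'] (e : K ≃+* K') (Φ' : Set (K' →+* ℂ))
    (hΨ : ∀ ψ : K' →+* ℂ, ψ ∈ Φ' ↔ ψ.comp e.toRingHom ∈ Ψ.1)
    (M : Type) [Field M] [NumberField M] (k : K' →+* M)
    (A : AbelianVariety ℂ) (ιA : 𝓞 M →+* End A) (θA : M →+* Module.End ℂ (complexBetti A.X 1))
    (ΦA : CMType M) (hΦA : ∀ θ : M →+* ℂ, θ ∈ ΦA.1 ↔ θ.comp k ∈ Φ')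
    (hA : IsCMTypeRealisation ΦA A ιA θA) (τ : M →+* ℂ) (hτ : τ.comp (k.comp e.toRingHom) = σ)
    (α : ℂ ⊗[ℚ] bettiCohomology A.X 1)
    (hα : α ∈ eigenline (HodgeCM.CM.CommonReflex.complexify (cmAction θA hA.isInducedOnIntegers)) τ)
    {L : CMField} {ι₁ : L →+* ℂ} (V : HermSpace3 L ι₁) (Γ : Level V)
    (f : (pmsRealisation (ballQuotientUniformisedDatum_of h₁) (pmsCode L ι₁ V Γ)).X ⟶ A.X) :
    (pull f 1).baseChange ℂ α ∈
      (CommonReflexInput.ofReflexData e Φ' hΨ M k A ιA θA ΦA hΦA hA τ hτ).surfaceClasses hHD hI h₁ h₃ V Γ :=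
  ⟨f, α, hα, rfl⟩

/-- The `∃ D, ∀ Γ f` packaging of the previous theorem (literally the `hJ5` shape). [folklore] -/
theorem exists_commonReflexInput_forall_pull_mem
    {K : CMField} {Ψ : CMType K} {σ : K →+* ℂ}
    {K' : Type} [Field K'] (e : K ≃+* K') (Φ' : Set (K' →+* ℂ))
    (hΨ : ∀ ψ : K' →+* ℂ, ψ ∈ Φ' ↔ ψ.comp e.toRingHom ∈ Ψ.1)
    (M : Type) [Field M] [NumberField M] (k : K' →+* M)
    (A : AbelianVariety ℂ) (ιA : 𝓞 M →+* End A) (θA : M →+* Module.End ℂ (complexBetti A.X 1))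
    (ΦA : CMType M) (hΦA : ∀ θ : M →+* ℂ, θ ∈ ΦA.1 ↔ θ.comp k ∈ Φ')
    (hA : IsCMTypeRealisation ΦA A ιA θA) (τ : M →+* ℂ) (hτ : τ.comp (k.comp e.toRingHom) = σ)
    (α : ℂ ⊗[ℚ] bettiCohomology A.X 1)
    (hα : α ∈ eigenline (HodgeCM.CM.CommonReflex.complexify (cmAction θA hA.isInducedOnIntegers)) τ)
    {L : CMField} {ι₁ : L →+* ℂ} (V : HermSpace3 L ι₁) :
    ∃ D : CommonReflexInput K Ψ σ, D.A = A ∧ ∀ (Γ : Level V)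
      (f : (pmsRealisation (ballQuotientUniformisedDatum_of h₁) (pmsCode L ι₁ V Γ)).X ⟶ A.X),
      (pull f 1).baseChange ℂ α ∈ D.surfaceClasses hHD hI h₁ h₃ V Γ :=
  ⟨CommonReflexInput.ofReflexData e Φ' hΨ M k A ιA θA ΦA hΦA hA τ hτ, rfl, fun Γ f =>
    pull_baseChange_mem_surfaceClasses_ofReflexData hHD hI h₁ h₃ e Φ' hΨ M k A ιA θA ΦA hΦA hA τ hτ α hα V Γ f⟩

/-! ### Packaged form: a CM-side record per `μ` (context-free) and the corner predicate (per context) -/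

/-- **CM-side data for one weight-one `μ`, typed RELATIVE TO A REFLEX PAIR** — the context-free half of the binder list of
`CommonReflexInput.ofReflexData` ([Liu21] Def. 4.3: the reflex pair `(M'_μ, Ψ_μ)` = `(K', Φ')`; Def. 4.5: `M_μ ⊇ M'_μ` = `k`, the abelian
variety `A_μ ⊗ ℂ` with `M_μ`-multiplication of CM type the inflation of `Ψ_μ` = `(A, ιA, θA, ΦA, hΦA, isRealisation)`, `M_μ ⊂ ℂ` = `τ`; proof of
Thm. 4.18: the `τ`-eigenvector `α`).  DATA, asserted by no one (a dictionary carries one per `μ`; PROVENANCE — that `A` is `A_μ ⊗_{E,τ'} ℂ`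
for an object of `𝒜(μ)`, Prop. 4.6 (1) — is the instantiator's docstring obligation, J3-DESIGN r9). [folklore] -/
structure LiuCMSide : Type 1 where
  /-- the reflex field `M'_μ` (abstract) -/
  K' : Type
  [instField : Field K']
  /-- the reflex type `Ψ_μ ⊆ Hom(M'_μ, ℂ)` -/
  Φ' : Set (K' →+* ℂ)
  /-- `M_μ` -/
  M : Type
  [instFieldM : Field M]
  [instNumberFieldM : NumberField M]
  /-- `M'_μ ⊆ M_μ` -/
  k : K' →+* M
  /-- `A_μ ⊗ ℂ` -/
  A : AbelianVariety ℂ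
  /-- `𝓞_{M_μ}`-multiplication -/
  ιA : 𝓞 M →+* End A
  /-- the action on `H¹(A; ℂ)` -/
  θA : M →+* Module.End ℂ (complexBetti A.X 1)
  /-- the CM type of `A` … -/
  ΦA : CMType M
  /-- … is the inflation of `Φ'` along `k` -/
  hΦA : ∀ θ : M →+* ℂ, θ ∈ ΦA.1 ↔ θ.comp k ∈ Φ'
  /-- `(A, ιA, θA)` realises `(M; ΦA)` on `H¹` -/
  isRealisation : IsCMTypeRealisation ΦA A ιA θA
  /-- `M_μ ⊂ ℂ` -/
  τ : M →+* ℂ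
  /-- the class `α` of (4.3) … -/
  α : ℂ ⊗[ℚ] bettiCohomology A.X 1
  /-- … is a `τ`-eigenvector -/
  α_mem : α ∈ eigenline (HodgeCM.CM.CommonReflex.complexify (cmAction θA isRealisation.isInducedOnIntegers)) τ

attribute [instance] LiuCMSide.instField LiuCMSide.instFieldM LiuCMSide.instNumberFieldM

namespace LiuCMSide

/-- **The corner predicate** (per context; the (J4a)+(J5) input): the corner `(K, Ψ, σ)` MATCHES the reflex pair of `C` — an isomorphism
`e : K ≃+* C.K'` carrying `Ψ` to `Φ'` and `σ` to `τ ∘ k ∘ e`. [folklore] -/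
def IsCorner (C : LiuCMSide) (K : CMField) (Ψ : CMType K) (σ : K →+* ℂ) : Prop :=
  ∃ e : K ≃+* C.K', (∀ ψ : C.K' →+* ℂ, ψ ∈ C.Φ' ↔ ψ.comp e.toRingHom ∈ Ψ.1) ∧ C.τ.comp (C.k.comp e.toRingHom) = σ

/-- **`hJ5` from the corner predicate**: a `D : CommonReflexInput K Ψ σ` with `D.A = C.A` all of whose surface classes contain every
`(f^*)_ℂ α`, `f : P_Γ ⟶ C.A` a `ℂ`-morphism, at every level. [folklore] -/
theorem exists_commonReflexInput_of_isCorner (C : LiuCMSide) {K : CMField} {Ψ : CMType K} {σ : K →+* ℂ}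
    (h : C.IsCorner K Ψ σ) {L : CMField} {ι₁ : L →+* ℂ} (V : HermSpace3 L ι₁) :
    ∃ D : CommonReflexInput K Ψ σ, D.A = C.A ∧ ∀ (Γ : Level V)
      (f : (pmsRealisation (ballQuotientUniformisedDatum_of h₁) (pmsCode L ι₁ V Γ)).X ⟶ C.A.X),
      (pull f 1).baseChange ℂ C.α ∈ D.surfaceClasses hHD hI h₁ h₃ V Γ := by
  obtain ⟨e, hΨ, hτ⟩ := h
  exact exists_commonReflexInput_forall_pull_mem hHD hI h₁ h₃ e C.Φ' hΨ C.M C.k C.A C.ιA C.θA C.ΦA C.hΦA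
    C.isRealisation C.τ hτ C.α C.α_mem V

end LiuCMSide

end Model

end HodgeCM

end
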